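import Mathlib.RingTheory.PowerSeries.Substitution
import Mathlib.RingTheory.PowerSeries.Expand
import Mathlib.RingTheory.PowerSeries.Derivative
import Mathlib.RingTheory.PowerSeries.Trunc
import Mathlib.RingTheory.PowerSeries.Order
import Mathlib.RingTheory.PowerSeries.NoZeroDivisors
import Mathlib.Algebra.Polynomial.Taylor
import Mathlib.Algebra.CharP.Frobenius
import Mathlib.Algebra.CharP.Quotient
import Mathlib.RingTheory.Ideal.Quotient.Basic
import Mathlib.NumberTheory.Padics.RingHoms
import Mathlib.RingTheory.WittVector.Identities
import Mathlib.RingTheory.WittVector.Domain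
import Mathlib.FieldTheory.Perfect
import Literature.NumberTheory.EllipticCurves.DivisionPolynomialFormalMulProofs
import Literature.NumberTheory.EllipticCurves.FormalGroupHasseInvariantProofs
import Literature.RingTheory.FormalGroups.FunctionalEquationIntegrality
import Literature.NumberTheory.EllipticCurves.FormalGroupMultiplicationUniversalProofs
import Literature.NumberTheory.EllipticCurves.FormalGroupLogHomProofs
import Literature.RingTheory.FormalGroups.HondaTypeTransport
import Literature.NumberTheory.EllipticCurves.FormalMulTwoSecondCoeffProofs
import Mathlib.RingTheory.WittVector.FrobeniusFractionField
import Mathlib.RingTheory.WittVector.Compare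
import Mathlib.FieldTheory.Finite.Basic
import Literature.NumberTheory.EllipticCurves.FormalLogExpBaseChangeProofs
import HarnessLib

/-!
# THEOREM K (the 2-adic Kummer class law for `z²(x(z) − x₀)`), kernel formalisation — KEtaKernelA
(crux `StarGO2Sigma`, stmt-BirchSwinnertonDyer-27046; line kummer, research stub `stub_discrepancyCover`)

Planner bsd-rank2-p2 GEN 36–37's K-UNIV / K-ETA kernel files (HOME/p2/g37/lean, memo K-UNIV.md; monolith
`KummerTheoremK_full.lean`, lean rc 0, 0 sorries), landed by the lead star-p1 GEN 12 in ≤ 400-line parts, verbatim except for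
file packaging.  This part: THEOREM K kernel, part A: general power-series lemmas, domains, characteristic 2, the Frobenius-lift setting and Dwork witnesses (`FrobeniusLiftData`, `phi`, `exists_delta`).
Nothing here reads `r_an`; `StarGO2Sigma` / E1M / BSD are NOT proved by this file.
-/

set_option linter.dupNamespace false
set_option linter.unusedSectionVars false
set_option autoImplicit false

noncomputable section

open PowerSeries

namespace Summit.BirchSwinnertonDyer.BirchSwinnertonDyer.Theorems.DepletionAtTwo.KEta.Kernel

/-! ### General power-series lemmas -/

section General

variable {A : Type*} [CommRing A]

/-- `(f∘a)(0) = f(0)` for `a(0) = 0`. [folklore] -/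
theorem constantCoeff_subst_of_constantCoeff_eq_zero {a : A⟦X⟧} (ha : constantCoeff a = 0) (f : A⟦X⟧) :
    constantCoeff (f.subst a) = constantCoeff f := by
  have has : HasSubst a := HasSubst.of_constantCoeff_zero' ha
  rw [← coeff_zero_eq_constantCoeff_apply, coeff_subst' has, finsum_eq_single _ 0]
  · simp
  · intro d hd
    have : coeff 0 (a ^ d) = 0 := by
      rw [coeff_zero_eq_constantCoeff_apply, map_pow, ha, zero_pow hd]
    rw [this, smul_zero]

/-- Continuity of substitution: the `n`-th coefficient of `f∘a` (`a(0) = 0`) only sees `f mod X^m`, `m > n`.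
[folklore] -/
theorem coeff_subst_eq_coeff_trunc_subst {a : A⟦X⟧} (ha : constantCoeff a = 0) {n m : ℕ} (h : n < m)
    (f : A⟦X⟧) : coeff n (f.subst a) = coeff n ((trunc m f : A⟦X⟧).subst a) := by
  have has : HasSubst a := HasSubst.of_constantCoeff_zero' ha
  rw [coeff_subst' has, coeff_subst' has]
  apply finsum_congr
  intro d
  by_cases hd : d < m
  · rw [coeff_coe_trunc_of_lt hd]
  · have hnd : (n : ℕ∞) < d := by exact_mod_cast lt_of_lt_of_le h (not_lt.mp hd)
    have : coeff n (a ^ d) = 0 :=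
      coeff_of_lt_order n (lt_of_lt_of_le hnd (le_order_pow_of_constantCoeff_eq_zero d ha))
    rw [this, smul_zero, smul_zero]

/-- **Taylor's formula on a square-zero thickening.** For `Y, E ∈ XA⟦X⟧` with `E² = 0`:
`f(Y + E) = f(Y) + f′(Y)·E`. [folklore] -/
theorem subst_add_of_mul_self_eq_zero {Y E : A⟦X⟧} (hY : constantCoeff Y = 0) (hE : constantCoeff E = 0)
    (hE2 : E * E = 0) (f : A⟦X⟧) :
    f.subst (Y + E) = f.subst Y + (d⁄dX A f).subst Y * E := by
  have hYE : constantCoeff (Y + E) = 0 := by rw [map_add, hY, hE, add_zero]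
  have hsY : HasSubst Y := HasSubst.of_constantCoeff_zero' hY
  have hsYE : HasSubst (Y + E) := HasSubst.of_constantCoeff_zero' hYE
  ext n
  rw [coeff_subst_eq_coeff_trunc_subst hYE (Nat.lt_succ_self n), map_add,
    coeff_subst_eq_coeff_trunc_subst hY (Nat.lt_succ_self n) f]
  have hE' : coeff n ((d⁄dX A f).subst Y * E) =
      coeff n ((Polynomial.derivative (trunc (n + 1) f) : A⟦X⟧).subst Y * E) := by
    rw [coeff_mul, coeff_mul]
    refine Finset.sum_congr rfl fun ij hij => ?_
    rcases ij with ⟨i, j⟩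
    have hijn : i + j = n := Finset.HasAntidiagonal.mem_antidiagonal.mp hij
    rcases Nat.eq_zero_or_pos j with rfl | hj
    · rw [coeff_zero_eq_constantCoeff_apply, hE, mul_zero, mul_zero]
    · have hi : i < n := by omega
      rw [← trunc_derivative, ← coeff_subst_eq_coeff_trunc_subst hY hi]
  rw [hE', subst_coe hsYE, subst_coe hsY, subst_coe hsY,
    Polynomial.aeval_add_of_sq_eq_zero _ _ _ (by rw [sq, hE2]), map_add]

/-- `d/dX` commutes with `map`. [folklore] -/
theorem derivative_map' {B : Type*} [CommRing B] (φ : A →+* B) (f : A⟦X⟧) :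
    d⁄dX B (f.map φ) = (d⁄dX A f).map φ := by
  ext n
  simp [coeff_derivative, coeff_map]

/-- `map g (map f u) = map (g ∘ f) u`. [folklore] -/
theorem map_map_apply' {B C' : Type*} [CommRing B] [CommRing C'] (f : A →+* B) (g : B →+* C') (u : A⟦X⟧) :
    (u.map f).map g = u.map (g.comp f) := by
  ext n
  simp [coeff_map]

/-- `a(0) = 0 ⇒ (φ_* a)(0) = 0`. [folklore] -/
theorem constantCoeff_map_eq_zero {B : Type*} [CommRing B] (φ : A →+* B) {a : A⟦X⟧}
    (ha : constantCoeff a = 0) : constantCoeff (a.map φ) = 0 := by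
  rw [← coeff_zero_eq_constantCoeff_apply, coeff_map, coeff_zero_eq_constantCoeff_apply, ha, map_zero]

/-- `PowerSeries.map_subst` with `PowerSeries.map` on the left (as in the tree's
`Literature.RingTheory.FormalGroups.DworkFrobeniusLift`). [folklore] -/
theorem map_subst_apply' {B : Type*} [CommRing B] {a : A⟦X⟧} (ha : HasSubst a) (h : A →+* B)
    (f : A⟦X⟧) : PowerSeries.map h (f.subst a) = (f.map h).subst (a.map h) :=
  map_subst ha f

/-- If every coefficient of `f` is divisible by `t` (witnessed in the quotient `A/(t)`), then `f = t·R`.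
[folklore] -/
theorem exists_eq_C_mul_of_map_mk_eq_zero (t : A) {f : A⟦X⟧}
    (h : f.map (Ideal.Quotient.mk (Ideal.span {t})) = 0) : ∃ R : A⟦X⟧, f = C t * R := by
  have hc : ∀ n, ∃ r : A, coeff n f = t * r := by
    intro n
    have hn : Ideal.Quotient.mk (Ideal.span {t}) (coeff n f) = 0 := by
      rw [← coeff_map, h, map_zero]
    obtain ⟨r, hr⟩ := Ideal.mem_span_singleton'.mp (Ideal.Quotient.eq_zero_iff_mem.mp hn)
    exact ⟨r, by rw [← hr, mul_comm]⟩
  choose r hr using hc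
  refine ⟨PowerSeries.mk r, ?_⟩
  ext n
  rw [coeff_C_mul, coeff_mk, hr]

/-- `2·f = 0 ⇒ f = 0` coefficientwise, from the same property of the coefficient ring. [folklore] -/
theorem eq_zero_of_two_mul_eq_zero (h2 : ∀ a : A, 2 * a = 0 → a = 0) {f : A⟦X⟧} (h : 2 * f = 0) : f = 0 := by
  ext n
  have hn := congrArg (coeff n) h
  rw [show (2 : A⟦X⟧) = C (2 : A) from (map_ofNat C 2).symm, coeff_C_mul, map_zero] at hn
  rw [map_zero]
  exact h2 _ hn

end General

/-! ### Injectivity of substitution over a domain -/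

section Domain

variable {k : Type*} [CommRing k] [NoZeroDivisors k]

/-- **`f ↦ f∘h` is injective** on `k⟦X⟧` for `k` without zero divisors, `h ≠ 0`, `h(0) = 0`. [folklore] -/
theorem eq_zero_of_subst_eq_zero {h : k⟦X⟧} (hh0 : constantCoeff h = 0) (hh : h ≠ 0) {f : k⟦X⟧}
    (hf : f.subst h = 0) : f = 0 := by
  by_contra hne
  have hsh : HasSubst h := HasSubst.of_constantCoeff_zero' hh0
  -- `f = X^m · f₁` with `f₁(0) ≠ 0`
  have hdec : (X : k⟦X⟧) ^ f.order.toNat * divXPowOrder f = f := X_pow_order_mul_divXPowOrder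
  have hf₁ : constantCoeff (divXPowOrder f) ≠ 0 := by
    rw [Ne, constantCoeff_divXPowOrder_eq_zero_iff]; exact hne
  have hsub : f.subst h = h ^ f.order.toNat * (divXPowOrder f).subst h := by
    conv_lhs => rw [← hdec]
    rw [← coe_substAlgHom hsh, map_mul, map_pow, coe_substAlgHom hsh, subst_X hsh]
  have h1 : (divXPowOrder f).subst h ≠ 0 := by
    intro h0
    apply hf₁
    rw [← constantCoeff_subst_of_constantCoeff_eq_zero hh0 (divXPowOrder f), h0, map_zero]
  exact (mul_ne_zero (pow_ne_zero _ hh) h1) (hsub ▸ hf)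

end Domain

/-! ### Characteristic `2`: Frobenius, `expand` and the derivative -/

section CharTwo

variable {k : Type*} [CommRing k] [CharP k 2]

/-- K-UNIV kernel lemma (THEOREM K formalisation, p2 GEN 37); see the file docstring. [folklore] -/
theorem two_ne_zero' : (2 : ℕ) ≠ 0 := by decide

/-- `(2 : k⟦X⟧) = 0`. [folklore] -/
theorem two_eq_zero : (2 : k⟦X⟧) = 0 := by
  have h2 : (2 : k) = 0 := by simpa using CharP.cast_eq_zero k 2
  rw [show (2 : k⟦X⟧) = C (2 : k) from (map_ofNat C 2).symm, h2, map_zero]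

/-- In characteristic `2`: `a + b = 0 ⇒ a = b`. [folklore] -/
theorem eq_of_add_eq_zero {a b : k⟦X⟧} (h : a + b = 0) : a = b := by
  linear_combination h - b * (two_eq_zero (k := k))

/-- **`(Frob_* f)(X²) = f²` in `k⟦X⟧`, `char k = 2`** (Mathlib `MvPowerSeries.map_frobenius_expand`).
[folklore] -/
theorem expand_map_frobenius (f : k⟦X⟧) :
    expand 2 two_ne_zero' (f.map (frobenius k 2)) = f ^ 2 := by
  haveI : ExpChar k 2 := ExpChar.prime Nat.prime_two
  rw [← map_expand]
  exact MvPowerSeries.map_frobenius_expand 2 two_ne_zero'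

/-- `f² = (Frob_* f)∘(X²)` as a substitution. [folklore] -/
theorem sq_eq_map_frobenius_subst (f : k⟦X⟧) :
    f ^ 2 = (f.map (frobenius k 2)).subst ((X : k⟦X⟧) ^ 2) := by
  rw [← expand_map_frobenius, expand_apply]

/-- Frobenius commutes with `d/dX` (because `n² = n` in `𝔽₂`). [folklore] -/
theorem map_frobenius_derivative (f : k⟦X⟧) :
    (d⁄dX k f).map (frobenius k 2) = d⁄dX k (f.map (frobenius k 2)) := by
  ext n
  simp only [coeff_map, coeff_derivative, map_mul]
  congr 1
  rw [show ((n : k) + 1) = ((n + 1 : ℕ) : k) by push_cast; ring, map_natCast (frobenius k 2)]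

/-- **`(Frob_* f)′(w²) = (f′(w))²`** for `w(0) = 0`, `char k = 2`. [folklore] -/
theorem derivative_map_frobenius_subst_sq {w : k⟦X⟧} (hw : constantCoeff w = 0) (f : k⟦X⟧) :
    (d⁄dX k (f.map (frobenius k 2))).subst (w ^ 2) = ((d⁄dX k f).subst w) ^ 2 := by
  have hsw : HasSubst w := HasSubst.of_constantCoeff_zero' hw
  have hsX2 : HasSubst ((X : k⟦X⟧) ^ 2) := HasSubst.X_pow two_ne_zero'
  have hw2 : w ^ 2 = (w.map (frobenius k 2)).subst ((X : k⟦X⟧) ^ 2) := sq_eq_map_frobenius_subst w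
  rw [sq_eq_map_frobenius_subst ((d⁄dX k f).subst w), map_subst_apply' hsw, map_frobenius_derivative,
    subst_comp_subst_apply (HasSubst.of_constantCoeff_zero' (constantCoeff_map_eq_zero _ hw)) hsX2, ← hw2]

end CharTwo

/-! ### The Frobenius-lift setting and the Dwork witness -/

section Setting

variable {O : Type*} [CommRing O] {k : Type*} [CommRing k]

/-! **The setting `(O, σ, π : O → k)`.** Throughout, the three standing hypotheses are passed
explicitly: `h2r : ∀ a, 2a = 0 → a = 0` (`2` is a non-zero-divisor of `O`),
`hker : ∀ a, π a = 0 ↔ ∃ b, a = 2b` (`ker π = 2O`), `hfrob : ∀ a, π (σ a) = (π a)²` (`σ` lifts the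
Frobenius of `k` along `π`).  Intended: `ℤ₂ → 𝔽₂` with `σ = id`; `W(k) → k` with the Witt Frobenius
(`k` perfect of characteristic `2`), see `frobeniusLift_padicInt_two` / `frobeniusLift_wittVector`.
[K-UNIV.md §1] -/

variable (σ : O →+* O) (π : O →+* k)

/-- The Frobenius lift on power series: `φ(u) = (σ_* u)(X²)`. [K-UNIV.md §1] -/
def phi (u : O⟦X⟧) : O⟦X⟧ := expand 2 two_ne_zero' (u.map σ)

/-- K-UNIV kernel lemma (THEOREM K formalisation, p2 GEN 37); see the file docstring. [folklore] -/
theorem phi_def (u : O⟦X⟧) : phi σ u = expand 2 two_ne_zero' (u.map σ) := rfl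

/-- K-UNIV kernel lemma (THEOREM K formalisation, p2 GEN 37); see the file docstring. [folklore] -/
theorem phi_eq_subst (u : O⟦X⟧) : phi σ u = (u.map σ).subst ((X : O⟦X⟧) ^ 2) := by
  rw [phi, expand_apply]

/-- K-UNIV kernel lemma (THEOREM K formalisation, p2 GEN 37); see the file docstring. [folklore] -/
theorem phi_mul (u v : O⟦X⟧) : phi σ (u * v) = phi σ u * phi σ v := by
  simp [phi, map_mul]

/-- K-UNIV kernel lemma (THEOREM K formalisation, p2 GEN 37); see the file docstring. [folklore] -/
theorem phi_pow (u : O⟦X⟧) (n : ℕ) : phi σ (u ^ n) = phi σ u ^ n := by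
  simp [phi, map_pow]

/-- K-UNIV kernel lemma (THEOREM K formalisation, p2 GEN 37); see the file docstring. [folklore] -/
theorem constantCoeff_phi (u : O⟦X⟧) : constantCoeff (phi σ u) = σ (constantCoeff u) := by
  rw [phi, constantCoeff_expand, ← coeff_zero_eq_constantCoeff_apply, coeff_map, coeff_zero_eq_constantCoeff_apply]

variable {σ π}

/-- `π ∘ σ = Frob ∘ π` as ring maps. -/
theorem comp_eq_frobenius_comp [CharP k 2] (hfrob : ∀ a : O, π (σ a) = π a ^ 2) :
    π.comp σ = (frobenius k 2).comp π := by
  ext a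
  rw [RingHom.comp_apply, RingHom.comp_apply, frobenius_def, hfrob]

/-- **`π_*(φu) = (π_*u)²`.** [folklore] -/
theorem map_phi [CharP k 2] (hfrob : ∀ a : O, π (σ a) = π a ^ 2) (u : O⟦X⟧) :
    (phi σ u).map π = (u.map π) ^ 2 := by
  rw [phi, map_expand, map_map_apply', comp_eq_frobenius_comp hfrob, ← map_map_apply', expand_map_frobenius]

/-- If `π_* f = 0` then `f = 2R`. [folklore] -/
theorem exists_eq_two_mul_of_map_eq_zero (hker : ∀ a : O, π a = 0 ↔ ∃ b : O, a = 2 * b) {f : O⟦X⟧} (h : f.map π = 0) :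
    ∃ R : O⟦X⟧, f = 2 * R := by
  have hc : ∀ n, ∃ r : O, coeff n f = 2 * r := by
    intro n
    have hn : π (coeff n f) = 0 := by rw [← coeff_map, h, map_zero]
    exact (hker _).mp hn
  choose r hr using hc
  refine ⟨PowerSeries.mk r, ?_⟩
  ext n
  rw [show (2 : O⟦X⟧) = C (2 : O) from (map_ofNat C 2).symm, coeff_C_mul, coeff_mk, hr]

/-- `π_*(2f) = 0`. [folklore] -/
theorem map_two_mul (hker : ∀ a : O, π a = 0 ↔ ∃ b : O, a = 2 * b) (f : O⟦X⟧) : (2 * f).map π = 0 := by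
  have h2 : π 2 = 0 := (hker 2).mpr ⟨1, by ring⟩
  rw [map_mul, show (2 : O⟦X⟧) = C (2 : O) from (map_ofNat C 2).symm, map_C, h2, map_zero, zero_mul]

/-- **Existence of the Dwork witness**: `φ(u) = u² + 2δ` for some `δ ∈ O⟦X⟧`. [folklore] -/
theorem exists_delta [CharP k 2] (hker : ∀ a : O, π a = 0 ↔ ∃ b : O, a = 2 * b) (hfrob : ∀ a : O, π (σ a) = π a ^ 2) (u : O⟦X⟧) :
    ∃ δ : O⟦X⟧, phi σ u = u ^ 2 + 2 * δ := by
  have h0 : (phi σ u - u ^ 2).map π = 0 := by rw [map_sub, map_phi hfrob, map_pow, sub_self]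
  obtain ⟨R, hR⟩ := exists_eq_two_mul_of_map_eq_zero hker h0
  exact ⟨R, by rw [← hR]; ring⟩

/-- `φ(u∘z) = (σ_*u)∘(φz)` for `z(0) = 0`. [folklore] -/
theorem phi_subst {z : O⟦X⟧} (hz : constantCoeff z = 0) (u : O⟦X⟧) :
    phi σ (u.subst z) = (u.map σ).subst (phi σ z) := by
  have hzσ : constantCoeff (z.map σ) = 0 := constantCoeff_map_eq_zero σ hz
  have hsz : HasSubst z := HasSubst.of_constantCoeff_zero' hz
  have hszσ : HasSubst (z.map σ) := HasSubst.of_constantCoeff_zero' hzσ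
  have hsX2 : HasSubst ((X : O⟦X⟧) ^ 2) := HasSubst.X_pow two_ne_zero'
  rw [phi_eq_subst, phi_eq_subst, map_subst_apply' hsz, subst_comp_subst_apply hszσ hsX2]

/-- `(σ_*u)∘(z²) = (φu)∘z`. [folklore] -/
theorem map_subst_sq {z : O⟦X⟧} (hz : constantCoeff z = 0) (u : O⟦X⟧) :
    (u.map σ).subst (z ^ 2) = (phi σ u).subst z := by
  have hsz : HasSubst z := HasSubst.of_constantCoeff_zero' hz
  have hsX2 : HasSubst ((X : O⟦X⟧) ^ 2) := HasSubst.X_pow two_ne_zero'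
  rw [phi_eq_subst, subst_comp_subst_apply hsX2 hsz, ← coe_substAlgHom hsz, map_pow, coe_substAlgHom hsz,
    subst_X hsz]

end Setting

end Summit.BirchSwinnertonDyer.BirchSwinnertonDyer.Theorems.DepletionAtTwo.KEta.Kernel

end
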